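import Mathlib.Combinatorics.SimpleGraph.AdjMatrix
import Mathlib.Combinatorics.SimpleGraph.DegreeSum
import Literature.InformationTheory.QuantumCodes.AdditiveCodeEquivalence
import Literature.InformationTheory.QuantumCodes.GF4LinearCodes
import Literature.InformationTheory.QuantumCodes.TypeIIAdditiveCodeCount
import HarnessLib

/-!
# Graph codes: every self-dual additive code is equivalent to a graph code (Danielsen–Parker Thm. 6);
# Type II graph codes = anti-Eulerian graphs (Danielsen–Parker Thm. 15)

Topic `Literature/InformationTheory/QuantumCodes` (LADDER-QEC, LIT-1 custody: the `[[n,0,d]]` column — self-dual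
additive codes and their classification by graphs).

**Source (read on the page).** L. E. Danielsen, M. G. Parker, *On the classification of all self-dual additive codes
over GF(4) of length up to 12*, J. Combin. Theory Ser. A 113 (2006) 1351–1367 = arXiv:math/0504522
[DanielsenParker2006], §3 (arXiv chunk p0006 L24–90): «Definition 5. A graph code is an additive code over GF(4) that
has a generator matrix of the form `C = Γ + ωI`, where `I` is the identity matrix and `Γ` is the adjacency matrix of a
simple undirected graph.» «Theorem 6. Every self-dual additive code over GF(4) is equivalent to a graph code. Proof.
(This proof is due to Van den Nest, Dehaene, and De Moor.) … the generator matrix … corresponds to an `n × 2n` binary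
matrix `(A|B)` … We must prove that [its row space] is also generated by `(Γ|I)` … If `B` is invertible, the solution
is simple, since `B⁻¹(A|B) = (Γ|I)`. Note that `Γ` will always be a symmetric matrix … If the `i`th diagonal element
of `Γ` is 1, it can be set to 0 by conjugating column `i` … In the case where `B` has rank `k < n` … [after a basis
change and a reordering] `B₁₁` and `A₂₂` are invertible … Interchanging column `i` of `A′` and column `i` of `B′`
corresponds to multiplication by `ω²` followed by conjugation … swap the `i`th columns of `A′` and `B′` for
`k < i ≤ n` … `B″` must also be an invertible matrix.»

In the tree's vocabulary (binary symplectic picture `Ē = 𝔽₂ⁿ × 𝔽₂ⁿ`, `v = (a | b)`; the `GF(4)` letter of a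
coordinate is the tree's dictionary of `SymplecticCodes`/`QuaternaryMacWilliams`; `𝒢ₙ = codeEquivGroup n` of
`AdditiveCodeEquivalence.lean`, which contains all `6ⁿ` local letter substitutions, so the statement below does not
depend on which of `a`, `b` is called the `ω`-component):

* `graphCode Γ` — the span of the rows of `(Γ | I)`: generator `i` has `a`-part the row `Γ_i` and `b`-part `e_i`;
  for symmetric `Γ` it is self-dual (`isSelfOrthogonal_graphCode`, `finrank_graphCode`, `sympDual_graphCode`).
* §1 `exists_smul_eq_graphCode_of_bijective_snd` — the case «`B` invertible»: a self-orthogonal `S̄` whose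
  `b`-projection `S̄ → 𝔽₂ⁿ` is bijective is carried by a product of one-coordinate letter substitutions
  `(a,b) ↦ (a+b, b)` (clearing the diagonal) to `graphCode Γ` with `Γ` symmetric and zero-diagonal.
* §2 `exists_bijective_snd_smul` — the case «`rank B = k < n`»: for a self-dual `S̄` there is a set `T` of coordinates
  such that after interchanging `a_i ↔ b_i` for `i ∈ T` the `b`-projection is bijective (`B″` invertible); coordinate
  free: `T` = the complement of a column basis `U` of the `b`-projection, and `A₂₂` invertible ⟸ isotropy.
* §3 `DanielsenParker2006_theorem6` — every self-dual additive code is `𝒢ₙ`-equivalent to a graph code with symmetric,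
  zero-diagonal `Γ`; `DanielsenParker2006_theorem6_graph` — the same with `Γ = G.adjMatrix (ZMod 2)` of a Mathlib
  `SimpleGraph (Fin n)` (every symmetric zero-diagonal matrix over `𝔽₂` `IsAdjMatrix`).
* §4 [DanielsenParker2006, §5 Thm. 15 (arXiv chunk p0010 L49–65)]: «Theorem 15. Let `Γ` be the adjacency matrix of
  the graph `G`. The code `𝒞` generated by `C = Γ + ωI` is of Type II if and only if `G` is anti-Eulerian, i.e., if
  all its vertices have odd degree. Proof. If `𝒞` is of Type II, then every row of `C` must have even weight. It
  follows that every row of `Γ` must have odd weight … Conversely, if all rows of `C` have even weight, `𝒞` must be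
  of Type II, since the codeword formed by adding any subset of these rows must also have even weight. This follows
  from the fact that for any two codewords of a self-dual code, there must be an even number of coordinates where
  the codewords have different non-zero values.» «It is easy to show that all anti-Eulerian graphs must have an even
  number of vertices, and it follows that all Type II codes must have even length.» — `DanielsenParker2006_theorem15`
  (matrix form: `IsEvenCode (graphCode Γ) ↔ ∀ i, Odd #{j | Γ i j ≠ 0}`), `DanielsenParker2006_theorem15_graph`
  (`↔ ∀ v, Odd (G.degree v)`), `even_card_of_forall_odd_degree` (Mathlib's handshake
  `SimpleGraph.even_card_odd_degree_vertices`), `DanielsenParker2006_typeII_antiEulerian` («Type II codes correspond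
  to anti-Eulerian graphs», §7 chunk p0012 L11–12, via Thm. 6 and `isEvenCode_smul_iff`); the printed corollary
  «all Type II codes must have even length» is then `even_card_of_forall_odd_degree` applied to that graph — it is
  the tree's `even_length_of_isEvenCode` (`SelfDualCodeBounds.lean`, proved there through characters) and is not
  restated.

* §5 [DanielsenParker2006, §4 Def. 8 + Thm. 11 (arXiv chunk p0008 L3–42)]: «Theorem 11. Let `Γ` be the adjacency
  matrix of the graph `G=(V,E)`, and `Γ^v` be the adjacency matrix of `G^v`, for any `v ∈ V`. The codes generated by
  `C = Γ + ωI` and `C' = Γ^v + ωI` are equivalent.» — `DanielsenParker2006_theorem11` (matrix form: `Γ^v` given by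
  `Γ^v_{ij} = Γ_{ij} + Γ_{vi}Γ_{vj}` off the diagonal), with the substitution `LocalDatum.shearDatum'`
  (`(a,b) ↦ (a, a+b)`, «multiply column `v` by `ω` and then conjugate»). The `SimpleGraph` form (the tree's
  `GraphStateLC.localComplement`) is in `GraphCodeLocalComplementation.lean`.

No named facts; no instances. Vocabulary: `codeEquivGroup`, `monomial`, `LocalDatum(.act)`, `letterAt`, `smul_eq_map`
(`AdditiveCodeEquivalence.lean`), `sympDual`, `sympInner`, `IsSelfOrthogonal`, `finrank_sympDual_add`
(`SymplecticCodes.lean`), `IsEvenCode` (`GF4LinearCodes.lean`), `evenSub` and `natCast_sympWeight_add_of_mem` = CRSS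
eq. (7) (`QuaternaryMacWilliams.lean`), `isEvenCode_smul_iff` (`TypeIIAdditiveCodeCount.lean`); Mathlib
`SimpleGraph.adjMatrix`, `Matrix.IsAdjMatrix(.toGraph)`, `SimpleGraph.degree`, `SimpleGraph.even_card_odd_degree_vertices`.

## Tree search (2026-08-27)
`rg -i "graph code|graphCode|adjacency"` over `Literature/InformationTheory/QuantumCodes`: no graph-state / graph-code
normal form for self-dual additive codes (Tanner-graph material only).
-/

namespace Literature.InformationTheory.QuantumCodes

open Finset Module

open scoped Pointwise

variable {n : ℕ}

/-! ### §0. Graph codes and two more local letter substitutions -/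

/-- **Graph code** of a binary matrix `Γ`: the additive code generated by the rows of `(Γ | I)` — generator `i` has
`a`-part the row `Γ_i` and `b`-part the unit vector `e_i` («a generator matrix of the form `Γ + ωI`»).
[cite: DanielsenParker2006, §3 Def. 5 (arXiv:math/0504522 chunk p0006 L24–26)] -/
def graphCode (Γ : Matrix (Fin n) (Fin n) (ZMod 2)) : Submodule (ZMod 2) (SympVec n) :=
  Submodule.span (ZMod 2) (Set.range fun i : Fin n => ((fun j => Γ i j, Pi.single i 1) : SympVec n))

/-- The rows of `(Γ | I)` lie in the graph code. [cite: DanielsenParker2006, §3 Def. 5] -/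
theorem row_mem_graphCode (Γ : Matrix (Fin n) (Fin n) (ZMod 2)) (i : Fin n) :
    ((fun j => Γ i j, Pi.single i 1) : SympVec n) ∈ graphCode Γ :=
  Submodule.subset_span ⟨i, rfl⟩

/-- The rows of `(Γ | I)` are pairwise orthogonal when `Γ` is symmetric: `(Γ_i|e_i)·(Γ_j|e_j) = Γ_ij + Γ_ji = 0`
(«`ΓIᵀ + IΓᵀ = 0`»). [cite: DanielsenParker2006, §3 (chunk p0006 L28–30, L47–48)] -/
theorem sympInner_row_row {Γ : Matrix (Fin n) (Fin n) (ZMod 2)} (hΓ : Γ.IsSymm) (i j : Fin n) :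
    sympInner ((fun k => Γ i k, Pi.single i 1) : SympVec n) ((fun k => Γ j k, Pi.single j 1) : SympVec n) = 0 := by
  classical
  rw [sympInner, dotProduct_single_one, dotProduct_single_one]
  have h : Γ j i = Γ i j := by
    have := congrFun (congrFun hΓ i) j
    simpa [Matrix.transpose_apply] using this
  show Γ i j + Γ j i = 0
  rw [h]
  have h2 : ∀ x : ZMod 2, x + x = 0 := by decide
  exact h2 _

/-- **A graph code (symmetric `Γ`) is self-orthogonal.** [cite: DanielsenParker2006, §3 (chunk p0006 L28–30: «A graph code is always self-dual, since its generator matrix has full rank over GF(2) and C C̄ᵀ only contains entries from GF(2) whose traces must be zero»)] -/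
theorem isSelfOrthogonal_graphCode {Γ : Matrix (Fin n) (Fin n) (ZMod 2)} (hΓ : Γ.IsSymm) :
    IsSelfOrthogonal (graphCode Γ) :=
  isSelfOrthogonal_span_range _ (sympInner_row_row hΓ)

/-- The rows of `(Γ | I)` are linearly independent («full rank over GF(2)»), so `dim graphCode Γ = n`.
[cite: DanielsenParker2006, §3 (chunk p0006 L28–29)] -/
theorem finrank_graphCode (Γ : Matrix (Fin n) (Fin n) (ZMod 2)) : finrank (ZMod 2) (graphCode Γ) = n := by
  classical
  have hli : LinearIndependent (ZMod 2) (fun i : Fin n => ((fun j => Γ i j, Pi.single i 1) : SympVec n)) := by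
    apply LinearIndependent.of_comp (LinearMap.snd (ZMod 2) (Fin n → ZMod 2) (Fin n → ZMod 2))
    have h : ⇑(LinearMap.snd (ZMod 2) (Fin n → ZMod 2) (Fin n → ZMod 2)) ∘
        (fun i : Fin n => ((fun j => Γ i j, Pi.single i 1) : SympVec n)) = ⇑(Pi.basisFun (ZMod 2) (Fin n)) := by
      funext i
      simp [Pi.basisFun_apply]
    rw [h]
    exact (Pi.basisFun (ZMod 2) (Fin n)).linearIndependent
  rw [graphCode, finrank_span_eq_card hli, Fintype.card_fin]

/-- **A graph code (symmetric `Γ`) is self-dual**: `(graphCode Γ)⊥ = graphCode Γ`.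
[cite: DanielsenParker2006, §3 (chunk p0006 L28–30)] -/
theorem sympDual_graphCode {Γ : Matrix (Fin n) (Fin n) (ZMod 2)} (hΓ : Γ.IsSymm) :
    sympDual (graphCode Γ) = graphCode Γ :=
  sympDual_eq_self_iff.2 ⟨isSelfOrthogonal_graphCode hΓ, finrank_graphCode Γ⟩

/-- The local letter substitution `(a, b) ↦ (a + b, b)` («conjugating column `i`» of `Γ + ωI`, which clears a
diagonal `1` of `Γ`). [cite: DanielsenParker2006, §3 proof of Thm. 6 (chunk p0006 L49–50)] -/
def LocalDatum.shearDatum : LocalDatum := ⟨((1, 0), (1, 1)), by decide⟩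

/-- [cite: DanielsenParker2006, §3 proof of Thm. 6] -/
theorem LocalDatum.shearDatum_act (p : ZMod 2 × ZMod 2) : LocalDatum.shearDatum.act p = (p.1 + p.2, p.2) := by
  unfold LocalDatum.act LocalDatum.shearDatum
  ext <;> simp

/-- The substitution `conjDatum` interchanges the `a`- and `b`-letters: `(a, b) ↦ (b, a)` («interchanging column `i`
of `A′` and column `i` of `B′` corresponds to multiplication by `ω²` followed by conjugation»).
[cite: DanielsenParker2006, §3 proof of Thm. 6 (chunk p0006 L84–85)] -/
theorem LocalDatum.conjDatum_act (p : ZMod 2 × ZMod 2) : LocalDatum.conjDatum.act p = (p.2, p.1) := by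
  unfold LocalDatum.act LocalDatum.conjDatum
  ext <;> simp

/-- Letters of a coordinatewise substitution `monomial 1 L`. [cite: CalderbankEtAl1998, §3 (printed p. 11)] -/
theorem letterAt_monomial_one (L : Fin n → LocalDatum) (v : SympVec n) (q : Fin n) :
    letterAt (monomial 1 L v) q = (L q).act (letterAt v q) := by
  rw [monomial_apply, letterAt_monomialMap]
  rfl

/-! ### §1. The case «`B` invertible» -/

/-- **Danielsen–Parker Thm. 6, case `B` invertible.** If `S̄` is self-orthogonal and its `b`-projection
`S̄ → 𝔽₂ⁿ` is bijective, then `S̄ = {(φ b | b)}` with `Γ₀ = [φ]` symmetric («`B⁻¹(A|B) = (Γ|I)` … `Γ` will always be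
a symmetric matrix, since `ΓIᵀ + IΓᵀ = 0`»), and clearing the diagonal by the substitutions `(a,b) ↦ (a+b,b)` at the
coordinates with `Γ₀ᵢᵢ = 1` gives `g • S̄ = graphCode Γ` with `Γ` symmetric and zero-diagonal.
[cite: DanielsenParker2006, §3 Thm. 6, proof, first case (arXiv:math/0504522 chunk p0006 L44–50)] -/
theorem exists_smul_eq_graphCode_of_bijective_snd {S : Submodule (ZMod 2) (SympVec n)} (hS : IsSelfOrthogonal S)
    (hbij : Function.Bijective fun v : S => (v : SympVec n).2) :
    ∃ g : codeEquivGroup n, ∃ Γ : Matrix (Fin n) (Fin n) (ZMod 2),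
      Γ.IsSymm ∧ (∀ i, Γ i i = 0) ∧ g • S = graphCode Γ := by
  classical
  -- `e : S̄ ≃ 𝔽₂ⁿ`, the `b`-projection
  let π : S →ₗ[ZMod 2] (Fin n → ZMod 2) := (LinearMap.snd (ZMod 2) (Fin n → ZMod 2) (Fin n → ZMod 2)).comp S.subtype
  have hπ : Function.Bijective π := hbij
  let e : S ≃ₗ[ZMod 2] (Fin n → ZMod 2) := LinearEquiv.ofBijective π hπ
  -- the basis `b i = e⁻¹(e_i)` of `S̄` and the matrix `Γ₀`
  set b : Fin n → SympVec n := fun i => ((e.symm (Pi.single i 1) : S) : SympVec n) with hb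
  have hb_mem : ∀ i, b i ∈ S := fun i => (e.symm (Pi.single i 1)).2
  have hb2 : ∀ i, (b i).2 = Pi.single i 1 := fun i => by
    have h := e.apply_symm_apply (Pi.single i 1)
    exact h
  set Γ₀ : Matrix (Fin n) (Fin n) (ZMod 2) := fun i j => (b i).1 j with hΓ₀
  have hΓ₀symm : ∀ i j, Γ₀ i j = Γ₀ j i := by
    intro i j
    have h : sympInner (b i) (b j) = 0 := (mem_sympDual_iff.1 (hS (hb_mem j))) (b i) (hb_mem i)
    rw [sympInner, hb2, hb2, dotProduct_single_one, dotProduct_single_one] at h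
    -- h : (b i).1 j + (b j).1 i = 0
    have : Γ₀ i j + Γ₀ j i = 0 := h
    have h2 : ∀ x y : ZMod 2, x + y = 0 → x = y := by decide
    exact h2 _ _ this
  -- the group element: shear at the coordinates with `Γ₀ q q = 1`
  let L : Fin n → LocalDatum := fun q => if Γ₀ q q = 1 then LocalDatum.shearDatum else LocalDatum.idDatum
  refine ⟨⟨monomial 1 L, monomial_mem_codeEquivGroup 1 L⟩, fun i j => if i = j then 0 else Γ₀ i j, ?_, ?_, ?_⟩
  · -- symmetric
    ext i j
    simp only [Matrix.transpose_apply]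
    by_cases h : i = j
    · subst h; rfl
    · rw [if_neg h, if_neg (Ne.symm h), hΓ₀symm]
  · intro i; simp
  · -- `g • S̄ = graphCode Γ`
    have hS_span : S = Submodule.span (ZMod 2) (Set.range b) := by
      apply le_antisymm
      · intro v hv
        have hv' : (⟨v, hv⟩ : S) = e.symm (π ⟨v, hv⟩) := (e.symm_apply_apply ⟨v, hv⟩).symm
        have hsum : v.2 = ∑ i, (v.2 i) • (Pi.single i 1 : Fin n → ZMod 2) := by
          ext j
          simp [Finset.sum_apply, Pi.single_apply]
        have hπv : π ⟨v, hv⟩ = v.2 := rfl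
        have h3 : v = ((e.symm (π ⟨v, hv⟩) : S) : SympVec n) := congrArg (fun w : S => (w : SympVec n)) hv'
        have : v = ∑ i, (v.2 i) • b i := by
          conv_lhs => rw [h3, hπv, hsum]
          rw [map_sum, Submodule.coe_sum]
          refine Finset.sum_congr rfl fun i _ => ?_
          rw [map_smul, Submodule.coe_smul]
        rw [this]
        exact Submodule.sum_mem _ fun i _ => Submodule.smul_mem _ _ (Submodule.subset_span ⟨i, rfl⟩)
      · exact Submodule.span_le.2 (by rintro _ ⟨i, rfl⟩; exact hb_mem i)
    rw [smul_eq_map, hS_span, Submodule.map_span, graphCode, ← Set.range_comp]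
    congr 1
    congr 1
    funext i
    simp only [Function.comp_apply, LinearEquiv.coe_coe]
    refine ext_letterAt fun q => ?_
    show letterAt (monomial 1 L (b i)) q = _
    rw [letterAt_monomial_one]
    simp only [letterAt, hb2, L]
    have hΓq : (b i).1 q = Γ₀ i q := rfl
    rw [hΓq]
    by_cases hq : Γ₀ q q = 1
    · rw [if_pos hq, LocalDatum.shearDatum_act]
      by_cases hiq : i = q
      · subst hiq
        simp [hq]
        decide
      · have : q ≠ i := Ne.symm hiq
        simp [this, hiq]
    · rw [if_neg hq, LocalDatum.idDatum_act]
      by_cases hiq : i = q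
      · subst hiq
        have h0 : Γ₀ i i = 0 := by
          have : ∀ x : ZMod 2, x ≠ 1 → x = 0 := by decide
          exact this _ hq
        simp [h0]
      · have : q ≠ i := Ne.symm hiq
        simp [this, hiq]

/-! ### §2. The case `rank B < n`: interchanging `a_i ↔ b_i` on the complement of a column basis of `B` -/

/-- **Danielsen–Parker Thm. 6, second case (Van den Nest–Dehaene–De Moor).** For a self-dual `S̄` there is a set of
coordinates on which interchanging the `a`- and `b`-letters (an element of `𝒢ₙ`) makes the `b`-projection
`g • S̄ → 𝔽₂ⁿ` bijective («we can therefore swap the `i`th columns of `A′` and `B′` for `k < i ≤ n` … `B″` must also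
be an invertible matrix»). Coordinate-free form of the printed argument: `U` = a column basis of the `b`-projection
`Z` of `S̄` (the coordinate functionals `z ↦ z_i`, `i ∈ U`, are a basis of `Z*`), `T = Uᶜ`; a vector of `S̄` whose
`b`-part vanishes on `U` and whose `a`-part vanishes on `T` has `b`-part `0` (injectivity of `z ↦ z|_U` on `Z`), so
lies in the kernel `K = S̄ ∩ (𝔽₂ⁿ × 0)`, whose `a`-parts are orthogonal to `Z` (isotropy) — and `z ↦ z|_U` maps `Z`
ONTO `𝔽₂^U` (dimension count), which kills an `a`-part supported on `U` («`A₂₂` is an invertible matrix»).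
[cite: DanielsenParker2006, §3 Thm. 6, proof, second case (arXiv:math/0504522 chunk p0006 L52–88)] -/
theorem exists_bijective_snd_smul {S : Submodule (ZMod 2) (SympVec n)} (hSD : sympDual S = S) :
    ∃ g : codeEquivGroup n, Function.Bijective fun v : ↥(g • S) => (v : SympVec n).2 := by
  classical
  have hSO : IsSelfOrthogonal S := le_of_eq hSD.symm
  have hdim : finrank (ZMod 2) S = n := by
    have h := finrank_sympDual_add S
    rw [hSD] at h
    omega
  -- `Z` = the `b`-projection of `S̄`, with its coordinate functionals
  let pZ : S →ₗ[ZMod 2] (Fin n → ZMod 2) := (LinearMap.snd (ZMod 2) (Fin n → ZMod 2) (Fin n → ZMod 2)).comp S.subtype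
  let Z : Submodule (ZMod 2) (Fin n → ZMod 2) := LinearMap.range pZ
  have hpZ : ∀ w : S, (w : SympVec n).2 ∈ Z := fun w => ⟨w, rfl⟩
  let f : Fin n → Module.Dual (ZMod 2) Z := fun i => (LinearMap.proj i).comp Z.subtype
  have hf : ∀ i (z : Z), f i z = (z : Fin n → ZMod 2) i := fun i z => rfl
  obtain ⟨U, hUind, hUspan⟩ := exists_maximal_linearIndepOn (ZMod 2) f
  -- (R1) `z ∈ Z`, `z|_U = 0 ⇒ z = 0`
  have R1 : ∀ z : Z, (∀ i ∈ U, (z : Fin n → ZMod 2) i = 0) → z = 0 := by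
    intro z h0
    apply Subtype.ext
    funext i
    by_cases hi : i ∈ U
    · exact h0 i hi
    · obtain ⟨a, ha, hmem⟩ := hUspan i hi
      have hvan : ∀ φ ∈ Submodule.span (ZMod 2) (f '' U), φ z = 0 := by
        intro φ hφ
        induction hφ using Submodule.span_induction with
        | mem φ hφ =>
          obtain ⟨j, hj, rfl⟩ := hφ
          exact h0 j hj
        | zero => rfl
        | add φ ψ _ _ h₁ h₂ => rw [LinearMap.add_apply, h₁, h₂, add_zero]
        | smul c φ _ h₁ => rw [LinearMap.smul_apply, h₁, smul_zero]
      have h1 := hvan _ hmem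
      have ha1 : a = 1 := by
        have key : ∀ b : ZMod 2, b ≠ 0 → b = 1 := by decide
        exact key a ha
      rw [ha1, one_smul] at h1
      exact h1
  -- (R2) the restriction `Z → 𝔽₂^U` is injective, hence (dimension of `Z*`) surjective
  let res : Z →ₗ[ZMod 2] (U → ZMod 2) := LinearMap.pi fun i : U => f i
  have hres : ∀ (z : Z) (i : U), res z i = (z : Fin n → ZMod 2) i := fun z i => rfl
  have hres_inj : Function.Injective res := by
    rw [← LinearMap.ker_eq_bot, LinearMap.ker_eq_bot']
    intro z hz
    exact R1 z fun i hi => by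
      have := congrArg (fun w => w ⟨i, hi⟩) hz
      exact this
  have hres_surj : Function.Surjective res := by
    have h1 : Fintype.card U ≤ finrank (ZMod 2) (Module.Dual (ZMod 2) Z) :=
      hUind.linearIndependent.fintype_card_le_finrank
    have h2 : finrank (ZMod 2) (Module.Dual (ZMod 2) Z) = finrank (ZMod 2) Z := Subspace.dual_finrank_eq
    have h3 : finrank (ZMod 2) (U → ZMod 2) = Fintype.card U := Module.finrank_fintype_fun_eq_card _
    have h4 : finrank (ZMod 2) Z ≤ finrank (ZMod 2) (U → ZMod 2) :=
      LinearMap.finrank_le_finrank_of_injective hres_inj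
    have heq : finrank (ZMod 2) Z = finrank (ZMod 2) (U → ZMod 2) := by omega
    exact (LinearMap.injective_iff_surjective_of_finrank_eq_finrank heq).1 hres_inj
  -- the interchange on `T = Uᶜ`
  let L : Fin n → LocalDatum := fun q => if q ∈ U then LocalDatum.idDatum else LocalDatum.conjDatum
  let g : codeEquivGroup n := ⟨monomial 1 L, monomial_mem_codeEquivGroup 1 L⟩
  refine ⟨g, ?_⟩
  -- the `b`-projection of `g • S̄` as a linear map; it is injective …
  let pZ' : ↥(g • S) →ₗ[ZMod 2] (Fin n → ZMod 2) :=
    (LinearMap.snd (ZMod 2) (Fin n → ZMod 2) (Fin n → ZMod 2)).comp (g • S).subtype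
  have hker : ∀ w ∈ S, (monomial 1 L w).2 = 0 → w = 0 := by
    intro w hw h0
    -- letters of `monomial 1 L w`
    have hlet : ∀ q, letterAt (monomial 1 L w) q =
        (if q ∈ U then (w.1 q, w.2 q) else (w.2 q, w.1 q)) := by
      intro q
      rw [letterAt_monomial_one]
      by_cases hq : q ∈ U
      · simp only [L, if_pos hq, LocalDatum.idDatum_act, letterAt]
      · simp only [L, if_neg hq, LocalDatum.conjDatum_act, letterAt]
    have hsnd : ∀ q, (letterAt (monomial 1 L w) q).2 = 0 := fun q => by
      show (monomial 1 L w).2 q = 0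
      rw [h0]; rfl
    have hbU : ∀ q ∈ U, w.2 q = 0 := fun q hq => by
      have h2 := hsnd q
      rw [hlet q, if_pos hq] at h2
      exact h2
    have haT : ∀ q ∉ U, w.1 q = 0 := fun q hq => by
      have h2 := hsnd q
      rw [hlet q, if_neg hq] at h2
      exact h2
    -- `b`-part: `w.2 ∈ Z` vanishes on `U`, hence `w.2 = 0`
    have hw2 : w.2 = 0 := by
      have h := R1 ⟨w.2, hpZ ⟨w, hw⟩⟩ hbU
      exact congrArg Subtype.val h
    -- `a`-part: supported on `U` and orthogonal to `Z = res⁻¹(everything)`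
    have hw1 : w.1 = 0 := by
      funext i
      by_cases hi : i ∈ U
      · obtain ⟨ζ, hζ⟩ := hres_surj (Pi.single ⟨i, hi⟩ 1)
        obtain ⟨w', hw'⟩ := ζ.2
        -- `hw' : pZ w' = ζ`, i.e. `(w').2 = ζ`
        have horth : sympInner w (w' : SympVec n) = 0 :=
          (mem_sympDual_iff.1 (hSO w'.2)) w hw
        rw [sympInner, hw2, dotProduct_zero, add_zero] at horth
        -- `w.1 ⬝ (w').2 = w.1 i`
        have hζq : ∀ q (hq : q ∈ U), ((w' : SympVec n)).2 q = if q = i then 1 else 0 := by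
          intro q hq
          have h1 : ((w' : SympVec n)).2 q = (ζ : Fin n → ZMod 2) q :=
            congrArg (fun z : Fin n → ZMod 2 => z q) hw'
          have h2 := congrArg (fun u => u ⟨q, hq⟩) hζ
          simp only [hres] at h2
          rw [h1, h2, Pi.single_apply]
          simp [Subtype.ext_iff]
        rw [dotProduct, Finset.sum_eq_single i] at horth
        · rw [hζq i hi, if_pos rfl, mul_one] at horth
          exact horth
        · intro q _ hqi
          by_cases hq : q ∈ U
          · rw [hζq q hq, if_neg hqi, mul_zero]
          · rw [haT q hq, zero_mul]
        · intro h; exact absurd (Finset.mem_univ i) h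
      · exact haT i hi
    exact Prod.ext hw1 hw2
  have hinj : Function.Injective pZ' := by
    rw [← LinearMap.ker_eq_bot, LinearMap.ker_eq_bot']
    rintro ⟨v, hv⟩ hv0
    rw [smul_eq_map, Submodule.mem_map] at hv
    obtain ⟨w, hw, rfl⟩ := hv
    have h0 : (monomial 1 L w).2 = 0 := hv0
    have := hker w hw h0
    subst this
    exact Subtype.ext (map_zero _)
  -- … and `dim (g • S̄) = n`, so it is bijective
  have hdim' : finrank (ZMod 2) ↥(g • S) = finrank (ZMod 2) (Fin n → ZMod 2) := by
    rw [finrank_smul, hdim, Module.finrank_fintype_fun_eq_card, Fintype.card_fin]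
  exact ⟨hinj, (LinearMap.injective_iff_surjective_of_finrank_eq_finrank hdim').1 hinj⟩

/-! ### §3. Theorem 6 -/

/-- **Danielsen–Parker 2006, Theorem 6 (Van den Nest–Dehaene–De Moor; Schlingemann; Grassl–Klappenecker–Rötteler;
Glynn et al.): every self-dual additive code over GF(4) is equivalent to a graph code.** For every self-dual
`S̄ = S̄⊥ ≤ Ē` there are `g ∈ 𝒢ₙ` and a symmetric zero-diagonal binary matrix `Γ` (the adjacency matrix of a simple
undirected graph) with `g • S̄ = graphCode Γ`.
[cite: DanielsenParker2006, §3 Thm. 6 (arXiv:math/0504522 chunk p0006 L34–88)] -/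
theorem DanielsenParker2006_theorem6 {S : Submodule (ZMod 2) (SympVec n)} (hSD : sympDual S = S) :
    ∃ g : codeEquivGroup n, ∃ Γ : Matrix (Fin n) (Fin n) (ZMod 2),
      Γ.IsSymm ∧ (∀ i, Γ i i = 0) ∧ g • S = graphCode Γ := by
  obtain ⟨g₁, hbij⟩ := exists_bijective_snd_smul hSD
  have hSO' : IsSelfOrthogonal (g₁ • S) := (isSelfOrthogonal_smul_iff g₁ S).2 (le_of_eq hSD.symm)
  obtain ⟨g₂, Γ, hΓ, hdiag, hΓS⟩ := exists_smul_eq_graphCode_of_bijective_snd hSO' hbij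
  exact ⟨g₂ * g₁, Γ, hΓ, hdiag, by rw [mul_smul, hΓS]⟩

/-- A symmetric zero-diagonal matrix over `𝔽₂` is the adjacency matrix of a simple undirected graph («`Γ` is the
adjacency matrix of a simple undirected graph»). [cite: DanielsenParker2006, §3 Def. 5 (chunk p0006 L24–26)] -/
theorem isAdjMatrix_of_isSymm {Γ : Matrix (Fin n) (Fin n) (ZMod 2)} (hΓ : Γ.IsSymm) (hdiag : ∀ i, Γ i i = 0) :
    Γ.IsAdjMatrix :=
  ⟨fun i j => (by decide : ∀ x : ZMod 2, x = 0 ∨ x = 1) _, hΓ, hdiag⟩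

/-- **Danielsen–Parker Thm. 6, graph form**: every self-dual additive code is `𝒢ₙ`-equivalent to the graph code of a
simple undirected graph `G` on the `n` coordinates (`Γ = G.adjMatrix`).
[cite: DanielsenParker2006, §3 Def. 5 and Thm. 6 (arXiv:math/0504522 chunk p0006 L24–88)] -/
theorem DanielsenParker2006_theorem6_graph {S : Submodule (ZMod 2) (SympVec n)} (hSD : sympDual S = S) :
    ∃ g : codeEquivGroup n, ∃ G : SimpleGraph (Fin n), ∃ _ : DecidableRel G.Adj,
      g • S = graphCode (G.adjMatrix (ZMod 2)) := by
  obtain ⟨g, Γ, hΓ, hdiag, hS⟩ := DanielsenParker2006_theorem6 hSD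
  have hA : Γ.IsAdjMatrix := isAdjMatrix_of_isSymm hΓ hdiag
  exact ⟨g, hA.toGraph, inferInstance, by rw [hA.adjMatrix_toGraph_eq, hS]⟩

/-! ### §4. Type II graph codes are the anti-Eulerian graphs: Theorem 15 -/

/-- The weight of the generator `(Γ_i | e_i)` of a graph code with `Γᵢᵢ = 0` is `deg i + 1` («every row of `C`
must have even weight. It follows that every row of `Γ` must have odd weight»).
[cite: DanielsenParker2006, §5 proof of Thm. 15 (chunk p0010 L55–56)] -/
theorem sympWeight_graphRow {Γ : Matrix (Fin n) (Fin n) (ZMod 2)} {i : Fin n} (hdiag : Γ i i = 0) :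
    sympWeight ((fun j => Γ i j, Pi.single i 1) : SympVec n) = #{j | Γ i j ≠ 0} + 1 := by
  classical
  unfold sympWeight
  have hset : (Finset.univ.filter fun j : Fin n => Γ i j ≠ 0 ∨ (Pi.single i (1 : ZMod 2) : Fin n → ZMod 2) j ≠ 0) =
      insert i (Finset.univ.filter fun j : Fin n => Γ i j ≠ 0) := by
    ext j
    simp only [Finset.mem_filter, Finset.mem_univ, true_and, Finset.mem_insert, Pi.single_apply]
    by_cases hji : j = i
    · subst hji; simp
    · simp [hji]
  have hi : i ∉ (Finset.univ.filter fun j : Fin n => Γ i j ≠ 0) := by simp [hdiag]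
  simp only [hset, Finset.card_insert_of_notMem hi]

/-- **A self-orthogonal set of even-weight generators spans an even code** («the codeword formed by adding any
subset of these rows must also have even weight … for any two codewords of a self-dual code, there must be an even
number of coordinates where the codewords have different non-zero values» — CRSS eq. (7): in a self-orthogonal code
`wt(u+v) ≡ wt u + wt v (mod 2)`, i.e. the even-weight words form the subcode `evenSub`).
[cite: DanielsenParker2006, §5 proof of Thm. 15 (chunk p0010 L57–60); CalderbankEtAl1998, §3 eq. (7) (printed p. 12)] -/
theorem isEvenCode_span_of_even {ι : Type*} (r : ι → SympVec n) (horth : ∀ i j, sympInner (r i) (r j) = 0)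
    (hev : ∀ i, Even (sympWeight (r i))) : IsEvenCode (Submodule.span (ZMod 2) (Set.range r)) := by
  have hS : IsSelfOrthogonal (Submodule.span (ZMod 2) (Set.range r)) := isSelfOrthogonal_span_range r horth
  have hle : Submodule.span (ZMod 2) (Set.range r) ≤ evenSub _ hS :=
    Submodule.span_le.2 (by rintro _ ⟨i, rfl⟩; exact ⟨Submodule.subset_span ⟨i, rfl⟩, hev i⟩)
  intro v hv
  exact (mem_evenSub.1 (hle hv)).2

/-- **Danielsen–Parker 2006, Theorem 15 (matrix form): a graph code is of Type II iff every vertex has odd degree.**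
For a symmetric zero-diagonal `Γ`: `graphCode Γ` is even iff `#{j | Γᵢⱼ ≠ 0}` is odd for every `i`.
[cite: DanielsenParker2006, §5 Thm. 15 (arXiv:math/0504522 chunk p0010 L49–61)] -/
theorem DanielsenParker2006_theorem15 {Γ : Matrix (Fin n) (Fin n) (ZMod 2)} (hΓ : Γ.IsSymm)
    (hdiag : ∀ i, Γ i i = 0) : IsEvenCode (graphCode Γ) ↔ ∀ i, Odd #{j | Γ i j ≠ 0} := by
  constructor
  · -- «every row of `C` must have even weight … every row of `Γ` must have odd weight»
    intro hev i
    have h := hev _ (row_mem_graphCode Γ i)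
    rw [sympWeight_graphRow (hdiag i), Nat.even_add_one, Nat.not_even_iff_odd] at h
    exact h
  · -- «the codeword formed by adding any subset of these rows must also have even weight»
    intro hodd
    refine isEvenCode_span_of_even _ (sympInner_row_row hΓ) fun i => ?_
    rw [sympWeight_graphRow (hdiag i)]
    exact (hodd i).add_one

/-- For a simple graph, `#{j | Γᵢⱼ ≠ 0} = deg i` with `Γ = G.adjMatrix (ZMod 2)`.
[cite: DanielsenParker2006, §5 Thm. 15 («i.e., if all its vertices have odd degree»)] -/
theorem card_adjMatrix_ne_zero_eq_degree (G : SimpleGraph (Fin n)) [DecidableRel G.Adj] (i : Fin n) :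
    #{j | G.adjMatrix (ZMod 2) i j ≠ 0} = G.degree i := by
  rw [← SimpleGraph.card_neighborFinset_eq_degree, SimpleGraph.neighborFinset_eq_filter]
  congr 1
  ext j
  simp [SimpleGraph.adjMatrix_apply]

/-- **Danielsen–Parker 2006, Theorem 15 (as printed): «Let `Γ` be the adjacency matrix of the graph `G`. The code `𝒞`
generated by `C = Γ + ωI` is of Type II if and only if `G` is anti-Eulerian, i.e., if all its vertices have odd
degree.»** [cite: DanielsenParker2006, §5 Thm. 15 (arXiv:math/0504522 chunk p0010 L49–61)] -/
theorem DanielsenParker2006_theorem15_graph (G : SimpleGraph (Fin n)) [DecidableRel G.Adj] :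
    IsEvenCode (graphCode (G.adjMatrix (ZMod 2))) ↔ ∀ v, Odd (G.degree v) := by
  rw [DanielsenParker2006_theorem15 (G.isSymm_adjMatrix (α := ZMod 2))
    (fun i => by simp [SimpleGraph.adjMatrix_apply])]
  simp only [card_adjMatrix_ne_zero_eq_degree]

/-- **«All anti-Eulerian graphs must have an even number of vertices»** (the handshake lemma: the number of
odd-degree vertices is even). [cite: DanielsenParker2006, §5 after Thm. 15 (chunk p0010 L63–65)] -/
theorem even_card_of_forall_odd_degree (G : SimpleGraph (Fin n)) [DecidableRel G.Adj]
    (hodd : ∀ v, Odd (G.degree v)) : Even n := by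
  have h := G.even_card_odd_degree_vertices
  rwa [Finset.filter_true_of_mem (fun v _ => hodd v), Finset.card_univ, Fintype.card_fin] at h

/-- **«Type II codes correspond to anti-Eulerian graphs»**: every Type II (even, self-dual) additive code is
`𝒢ₙ`-equivalent to the graph code of a graph all of whose vertices have odd degree (Thm. 6, Thm. 15, and
`𝒢ₙ` preserves weights); with `even_card_of_forall_odd_degree` this re-derives «all Type II codes must have even
length» (= the tree's `even_length_of_isEvenCode`). [cite: DanielsenParker2006, §5 Thm. 15 and §7 (chunk p0010 L49–61, p0012 L11–12)] -/
theorem DanielsenParker2006_typeII_antiEulerian {S : Submodule (ZMod 2) (SympVec n)} (hSD : sympDual S = S)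
    (hev : IsEvenCode S) :
    ∃ g : codeEquivGroup n, ∃ G : SimpleGraph (Fin n), ∃ _ : DecidableRel G.Adj,
      (∀ v, Odd (G.degree v)) ∧ g • S = graphCode (G.adjMatrix (ZMod 2)) := by
  obtain ⟨g, G, _, hS⟩ := DanielsenParker2006_theorem6_graph hSD
  refine ⟨g, G, inferInstance, ?_, hS⟩
  rw [← DanielsenParker2006_theorem15_graph, ← hS, isEvenCode_smul_iff]
  exact hev

/-! ### §5. Local complementation: Theorem 11 -/

/-- The local letter substitution `(a, b) ↦ (a, a + b)` («Multiply column `v` of `C` by `ω` and then conjugate the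
same column»). [cite: DanielsenParker2006, §4 proof of Thm. 11 (arXiv:math/0504522 chunk p0008 L34–41)] -/
def LocalDatum.shearDatum' : LocalDatum := ⟨((1, 1), (0, 1)), by decide⟩

/-- [cite: DanielsenParker2006, §4 proof of Thm. 11] -/
theorem LocalDatum.shearDatum'_act (p : ZMod 2 × ZMod 2) : LocalDatum.shearDatum'.act p = (p.1, p.1 + p.2) := by
  unfold LocalDatum.act LocalDatum.shearDatum'
  ext <;> simp

/-- **Danielsen–Parker 2006, Theorem 11 (local complementation preserves the code up to equivalence).** «Let `Γ` be
the adjacency matrix of the graph `G = (V,E)`, and `Γ^v` be the adjacency matrix of `G^v`, for any `v ∈ V`. The codes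
generated by `C = Γ + ωI` and `C' = Γ^v + ωI` are equivalent.» Here `G^v` is the local complement at `v`
(«replace the induced subgraph of `G` on `N_v` by its complement», Def. 8): `Γ^v_{ij} = Γ_{ij} + Γ_{vi}Γ_{vj}` for
`i ≠ j`, zero diagonal. Proof as printed: «For all `i ∈ N_v`, add row `v` of `C` to row `i` of `C`. Multiply column
`v` of `C` by `ω` and then conjugate the same column. Finally, conjugate column `i` of `C`, for all `i ∈ N_v`. The
resulting matrix is `C'`.» — the equivalence is the product of the one-coordinate substitutions `shearDatum'` at `v`
and `shearDatum` on `N_v`; it maps the generator `(Γ_i|e_i) + Γ_{vi}(Γ_v|e_v)` to `(Γ^v_i|e_i)`, and the two codes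
have the same dimension `n`.
[cite: DanielsenParker2006, §4 Def. 8 and Thm. 11 (arXiv:math/0504522 chunk p0008 L3–42)] -/
theorem DanielsenParker2006_theorem11 {Γ Γ' : Matrix (Fin n) (Fin n) (ZMod 2)} (hΓ : Γ.IsSymm)
    (hdiag : ∀ i, Γ i i = 0) (v : Fin n) (hΓ' : ∀ i j, Γ' i j = if i = j then 0 else Γ i j + Γ v i * Γ v j) :
    ∃ g : codeEquivGroup n, g • graphCode Γ = graphCode Γ' := by
  classical
  have hsymm : ∀ i j, Γ j i = Γ i j := fun i j => by
    have := congrFun (congrFun hΓ i) j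
    simpa [Matrix.transpose_apply] using this
  -- the substitutions: `shearDatum'` at `v`, `shearDatum` on `N_v`, identity elsewhere
  let L : Fin n → LocalDatum := fun q =>
    if q = v then LocalDatum.shearDatum' else if Γ v q = 1 then LocalDatum.shearDatum else LocalDatum.idDatum
  let g : codeEquivGroup n := ⟨monomial 1 L, monomial_mem_codeEquivGroup 1 L⟩
  refine ⟨g, ?_⟩
  -- rows of `(Γ|I)` and of `(Γ^v|I)`
  let r : Fin n → SympVec n := fun i => ((fun j => Γ i j, Pi.single i 1) : SympVec n)
  let t : Fin n → SympVec n := fun i => ((fun j => Γ' i j, Pi.single i 1) : SympVec n)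
  have hr : ∀ i q, letterAt (r i) q = (Γ i q, if q = i then 1 else 0) := fun i q => by
    simp [r, letterAt, Pi.single_apply]
  have ht : ∀ i q, letterAt (t i) q = (Γ' i q, if q = i then 1 else 0) := fun i q => by
    simp [t, letterAt, Pi.single_apply]
  -- «add row `v` of `C` to row `i` of `C`» for `i ∈ N_v`; then apply the substitutions: the result is row `i` of `C'`
  have key : ∀ i, monomial 1 L (r i + (if i = v then 0 else Γ v i) • r v) = t i := by
    intro i
    refine ext_letterAt fun q => ?_
    rw [letterAt_monomial_one, letterAt_add', letterAt_smul', hr, hr, ht, hΓ' i q]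
    have h01 : ∀ x : ZMod 2, x = 0 ∨ x = 1 := by decide
    by_cases hiv : i = v
    · subst hiv
      by_cases hqv : q = i
      · subst hqv
        simp only [L, if_true, LocalDatum.shearDatum'_act, hdiag]
        simp
      · have hiq : ¬ i = q := fun h => hqv h.symm
        simp only [L, if_neg hqv, if_true, zero_smul, add_zero, if_neg hiq, hdiag, zero_mul, add_zero]
        by_cases hq1 : Γ i q = 1
        · rw [if_pos hq1, LocalDatum.shearDatum_act, hq1]; simp
        · rw [if_neg hq1, LocalDatum.idDatum_act]
    · simp only [if_neg hiv]
      by_cases hqv : q = v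
      · subst hqv
        have hqi : ¬ q = i := fun h => hiv h.symm
        simp only [L, if_true, LocalDatum.shearDatum'_act, if_neg hqi, if_neg hiv, hdiag, Prod.smul_mk,
          smul_eq_mul, mul_zero, mul_one, Prod.mk_add_mk, add_zero, zero_add, hsymm q i]
        have h11 : (1 : ZMod 2) + 1 = 0 := by decide
        rcases h01 (Γ q i) with h | h <;> simp [h, h11]
      · by_cases hqi : q = i
        · subst hqi
          simp only [L, if_neg hqv, if_true, Prod.smul_mk, smul_eq_mul, mul_zero, Prod.mk_add_mk, add_zero,
            hdiag, zero_add]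
          rcases h01 (Γ v q) with h | h
          · simp [h]
          · rw [if_pos h, LocalDatum.shearDatum_act, h]; simp; decide
        · have hiq : ¬ i = q := fun h => hqi h.symm
          simp only [L, if_neg hqv, if_neg hqi, if_neg hiq, Prod.smul_mk, smul_eq_mul, mul_zero,
            Prod.mk_add_mk, add_zero]
          rcases h01 (Γ v q) with h | h
          · simp [h]
          · rw [if_pos h, LocalDatum.shearDatum_act]; simp
  -- `graphCode Γ' ≤ g • graphCode Γ`, and both have dimension `n`
  symm
  refine Submodule.eq_of_le_of_finrank_eq ?_ ?_
  · rw [graphCode, Submodule.span_le]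
    rintro _ ⟨i, rfl⟩
    rw [smul_eq_map, SetLike.mem_coe, Submodule.mem_map]
    exact ⟨_, Submodule.add_mem _ (row_mem_graphCode Γ i) (Submodule.smul_mem _ _ (row_mem_graphCode Γ v)),
      key i⟩
  · rw [finrank_smul, finrank_graphCode, finrank_graphCode]

end Literature.InformationTheory.QuantumCodes
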